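import Summits.CriticalPhenomena.PercolationContinuityZ3.Theorems.PercNearOneGluingAdditiveGluingBlockGrowth
import Summits.CriticalPhenomena.PercolationContinuityZ3.Theorems.PercNearOneGluingAdditiveGluingGluingLemma5
import HarnessLib

/-! # Crux `PercNearOneGluing.AdditiveGluing` (stmt-CriticalPhenomena-4576), line `peel` (skeleton v6) — stub `stub_relayLayersNoDrift_c5`

Helper file for the crux skeleton `Cruxes/AdditiveGluing/Lines/peel.lean` (lead
prover-line-stmt-CriticalPhenomena-4576).  Proves exactly the registered stub signature; lands with
`--supports stmt-CriticalPhenomena-4576`.  No definitions, no named facts.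

## Content

Notation: `μ_w = prodBernoulli w` on the weighted complete graph `Fin n`; for a block `L` of vertices,
`w/L` is the weighting with weight `1` on every non-loop pair inside `L` ("gluing the block", the explicit
lambda of `blockGrowth_glue_real_openConn`), `X_L = ⋃_{v ∈ L} {a₀ ↔ v}`, `Y_L = ⋃_{v ∈ L} {v ↔ b}`.

* `relayNoDrift_glue_absorb`: gluing `B ⊆ L` and then `L` is gluing `L`: `(w/B)/L = w/L`.
* `relayNoDrift_designated_le_reach` (the core inequality): if `B ⊆ L`, `a ∈ L` and
  `μ_w(a₀ ↔ b) ≤ μ_w(a ↔ b)`, then in the `B`-glued weighting `q = w/B`,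
  `μ_q(a₀ ↔ b) + μ_q(a₀ ↮ b, X_L, Y_L) ≤ μ_q(Y_L)`.
  Proof: if `b ∈ L` the right-hand side is `1`; otherwise the left-hand side is `μ_{q/L}(a₀ ↔ b)`
  and the right-hand side is `μ_{q/L}(Y_L)` (`blockGrowth_glue_real_openConn/iUnion`), `q/L = w/L`
  (absorption), and Kozma–Nitzan's Lemma 5 in block form (`stub_gluingLemma5`) gives
  `μ_{w/L}(a₀ ↔ b) ≤ μ_{w/L}(Y_L)`.
* `stub_relayLayersNoDrift_c5`: the registered stub — the relay-layer term of the pocket-free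
  certificate is non-negative at the designation `a₀` whenever `a₀` minimises the `x'`-star-killed
  two-point function over the relay set `A` and the layer block `S' ∪ B` meets `A`; this is the core
  inequality with `w` the star-killed weighting, `L = S' ∪ B` and `a` a relay in `L ∩ A`.
[cite: KozmaNitzan2024, §3.1 (gluing, Remark p. 5), §3.2 Lemma 5 (p. 13)]
-/

namespace Summit.CriticalPhenomena.PercolationContinuityZ3.Theorems

open MeasureTheory Set
open Literature.Probability.LatticeModels (prodBernoulli)
open Literature.Probability.Percolation (BondConfig openConn openConnIn openGraph openCluster)
open scoped BigOperators

noncomputable section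
open Classical

section RelayLayersNoDrift

open Literature.Probability.LatticeModels Literature.Probability.Percolation

variable {n : ℕ}

/-- **Glue absorption**: for `B ⊆ L`, gluing the block `L` after gluing the block `B` is gluing `L`,
`(w/B)/L = w/L` as weightings. [cite: KozmaNitzan2024, §3.1 (gluing, Remark p. 5)] -/
theorem relayNoDrift_glue_absorb (w : Sym2 (Fin n) → unitInterval) {B L : Finset (Fin n)}
    (hBL : B ⊆ L) :
    (fun e : Sym2 (Fin n) => if (∀ x ∈ e, x ∈ L) ∧ ¬ e.IsDiag then 1 else
        (if (∀ y ∈ e, y ∈ B) ∧ ¬ e.IsDiag then 1 else w e)) =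
      (fun e : Sym2 (Fin n) => if (∀ x ∈ e, x ∈ L) ∧ ¬ e.IsDiag then 1 else w e) := by
  funext e
  by_cases h : (∀ x ∈ e, x ∈ L) ∧ ¬ e.IsDiag
  · rw [if_pos h, if_pos h]
  · rw [if_neg h, if_neg h, if_neg]
    rintro ⟨hB, hd⟩
    exact h ⟨fun x hx => hBL (hB x hx), hd⟩

/-- **The core inequality (KN Lemma 5 after un-gluing).**  Let `B ⊆ L` be blocks, `a ∈ L`, and suppose
`μ_w(a₀ ↔ b) ≤ μ_w(a ↔ b)`.  Then in the `B`-glued weighting `q = w/B`,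
`μ_q(a₀ ↔ b) + μ_q(a₀ ↮ b, a₀ ↔ L, L ↔ b) ≤ μ_q(L ↔ b)`.
If `b ∈ L` the right-hand side is `1`; otherwise both sides are `L`-glued quantities
(`blockGrowth_glue_real_openConn/iUnion`), `q/L = w/L`, and `stub_gluingLemma5` applies with the
vertex `a ∈ L`. [cite: KozmaNitzan2024, §3.2 Lemma 5 (p. 13), §3.1 (gluing, Remark p. 5)] -/
theorem relayNoDrift_designated_le_reach (w : Sym2 (Fin n) → unitInterval) (B L : Finset (Fin n))
    (a₀ a b : Fin n) (hBL : B ⊆ L) (haL : a ∈ L)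
    (hle : (prodBernoulli w).real (openConn a₀ b) ≤ (prodBernoulli w).real (openConn a b)) :
    (prodBernoulli (fun e : Sym2 (Fin n) =>
        if (∀ y ∈ e, y ∈ B) ∧ ¬ e.IsDiag then 1 else w e)).real (openConn a₀ b)
      + (prodBernoulli (fun e : Sym2 (Fin n) =>
          if (∀ y ∈ e, y ∈ B) ∧ ¬ e.IsDiag then 1 else w e)).real
          ((openConn a₀ b)ᶜ ∩ (⋃ v ∈ L, openConn a₀ v) ∩ (⋃ v ∈ L, openConn v b))
      ≤ (prodBernoulli (fun e : Sym2 (Fin n) =>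
          if (∀ y ∈ e, y ∈ B) ∧ ¬ e.IsDiag then 1 else w e)).real (⋃ v ∈ L, openConn v b) := by
  by_cases hbL : b ∈ L
  · -- the target lies in the block: the block's reach of `b` is `1`
    have hY : (⋃ v ∈ L, openConn v b : Set (BondConfig (Fin n))) = Set.univ :=
      Set.eq_univ_of_forall fun ω =>
        Set.mem_iUnion₂.2 ⟨b, hbL, (SimpleGraph.Reachable.refl b : (openGraph ω).Reachable b b)⟩
    rw [hY, probReal_univ, Set.inter_univ]
    have h1 : (prodBernoulli (fun e : Sym2 (Fin n) =>
          if (∀ y ∈ e, y ∈ B) ∧ ¬ e.IsDiag then 1 else w e)).real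
          ((openConn a₀ b)ᶜ ∩ (⋃ v ∈ L, openConn a₀ v)) ≤
        (prodBernoulli (fun e : Sym2 (Fin n) =>
          if (∀ y ∈ e, y ∈ B) ∧ ¬ e.IsDiag then 1 else w e)).real (openConn a₀ b)ᶜ :=
      measureReal_mono Set.inter_subset_left (measure_ne_top _ _)
    have h2 : (prodBernoulli (fun e : Sym2 (Fin n) =>
          if (∀ y ∈ e, y ∈ B) ∧ ¬ e.IsDiag then 1 else w e)).real (openConn a₀ b)
        + (prodBernoulli (fun e : Sym2 (Fin n) =>
          if (∀ y ∈ e, y ∈ B) ∧ ¬ e.IsDiag then 1 else w e)).real (openConn a₀ b)ᶜ = 1 :=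
      probReal_add_probReal_compl MeasurableSet.of_discrete
    linarith
  · -- `b ∉ L`: KN Lemma 5 in the `L`-glued graph, then un-glue `L` on top of `B`
    have h5 := stub_gluingLemma5 n w L a₀ a b haL hbL hle
    rw [← relayNoDrift_glue_absorb w hBL, blockGrowth_glue_real_openConn,
      blockGrowth_glue_real_iUnion] at h5
    exact h5

end RelayLayersNoDrift

open Literature.Probability.LatticeModels Literature.Probability.Percolation in
/-- Registered stub `stub_relayLayersNoDrift_c5` of crux stmt-CriticalPhenomena-4576 (line `peel`,
skeleton v6): **the relay-layer term of the pocket-free certificate is non-negative at the designation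
`a₀` whenever `a₀` minimises the `x'`-star-killed two-point function over `A`.**  For the layer block
`S' ∪ B` meeting `A` (so containing a relay `a`), in `q_B` (= `u` with the star of `x'` killed and `B`
glued): `designated(a₀) = μ_{q_B}(a₀ ↔ b) + μ_{q_B}(a₀ ↮ b, a₀ ↔ S'∪B, S'∪B ↔ b) ≤ μ_{q_B}(S'∪B ↔ b)`
— `relayNoDrift_designated_le_reach` with `w` the star-killed weighting, `L = S' ∪ B ⊇ B` and the
relay `a` (`μ(a₀ ↔ b) ≤ μ(a ↔ b)` in the star-killed weighting is the minimiser hypothesis).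
[cite: KozmaNitzan2024, §3.2 Lemma 5 (p. 13)] -/
theorem stub_relayLayersNoDrift_c5 :
    ∀ (n : ℕ) (u : Sym2 (Fin n) → unitInterval) (A S' B : Finset (Fin n)) (b a₀ x' : Fin n),
      b ∈ A → Disjoint S' A → a₀ ∈ A →
      (∀ a ∈ A, (prodBernoulli (fun e : Sym2 (Fin n) => if (∃ y ∈ e, y ∈ ({x'} : Finset (Fin n))) then (0 : unitInterval) else u e)).real (openConn a₀ b) ≤ (prodBernoulli (fun e : Sym2 (Fin n) => if (∃ y ∈ e, y ∈ ({x'} : Finset (Fin n))) then (0 : unitInterval) else u e)).real (openConn a b)) →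
      ¬ Disjoint (S' ∪ B) A →
      0 ≤ (prodBernoulli (fun e : Sym2 (Fin n) => if (∀ y ∈ e, y ∈ B) ∧ ¬ e.IsDiag then 1 else if (∃ y ∈ e, y ∈ ({x'} : Finset (Fin n))) then 0 else u e)).real (⋃ v ∈ (S' ∪ B), openConn v b)
              - ((prodBernoulli (fun e : Sym2 (Fin n) => if (∀ y ∈ e, y ∈ B) ∧ ¬ e.IsDiag then 1 else if (∃ y ∈ e, y ∈ ({x'} : Finset (Fin n))) then 0 else u e)).real (openConn a₀ b)
                + (prodBernoulli (fun e : Sym2 (Fin n) => if (∀ y ∈ e, y ∈ B) ∧ ¬ e.IsDiag then 1 else if (∃ y ∈ e, y ∈ ({x'} : Finset (Fin n))) then 0 else u e)).real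
                    ((openConn a₀ b)ᶜ ∩ (⋃ v ∈ (S' ∪ B), openConn a₀ v) ∩ (⋃ v ∈ (S' ∪ B), openConn v b))) := by
  intro n u A S' B b a₀ x' _hbA _hS'A _ha₀A hmin hnd
  obtain ⟨a, haL, haA⟩ := Finset.not_disjoint_iff.1 hnd
  exact sub_nonneg.2 (relayNoDrift_designated_le_reach _ B (S' ∪ B) a₀ a b
    Finset.subset_union_right haL (hmin a haA))

end

end Summit.CriticalPhenomena.PercolationContinuityZ3.Theorems
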